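import Mathlib
import HarnessLib

/-!
# T72e — Chebyshev-type bounds for `Σ Λ(n)/n` and `Σ Λ(n)²/n` (solo-informed, rigidity line R2b)

Fifth file of the local pair-correlation rigidity line (sharpest statement §2k (xi), plan T72).
The mean square of the prime side of `Re Q(f_{b,t})` over a height window (T72a,
`norm_sq_dirichletSum_intervalIntegral_le`) is controlled by `Σ_{n ≤ e^b} Λ(n)²/n`, which must
be `O(b²)` (not `O(b³)`) for the rigidity lemma to reach scales `b ≍ log V`. This file proves the
two elementary bounds, from Mathlib's Chebyshev estimate `ψ(x) ≤ (log 4 + 4) x`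
(`Chebyshev.psi_le_const_mul_self`) by dyadic blocks:

* `sum_Ioc_vonMangoldt_div_le_block` — `Σ_{M < n ≤ 2M} Λ(n)/n ≤ 2(log 4 + 4)`;
* `sum_vonMangoldt_div_le_dyadic` — `Σ_{n ≤ 2^K} Λ(n)/n ≤ 2(log 4 + 4) K`;
* `sum_vonMangoldt_div_le` — `Σ_{n ≤ N} Λ(n)/n ≤ 22 log N + 11`;
* `sum_vonMangoldt_sq_div_le` — `Σ_{n ≤ N} Λ(n)²/n ≤ log N · (22 log N + 11)`.

(Mertens' `Σ_{n ≤ x} Λ(n)/n = log x + O(1)` would give the sharp constant; only the order is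
needed.)

References: P. L. Chebyshev, *Mémoire sur les nombres premiers*, J. Math. Pures Appl. 17 (1852)
366–390; G. H. Hardy, E. M. Wright, *An Introduction to the Theory of Numbers*, Thm 414 and §22.4.
-/

noncomputable section

open Finset Real
open scoped ArithmeticFunction Chebyshev

namespace Summit.RiemannHypothesis.RiemannHypothesis.Theorems

/-- One dyadic block: `Σ_{M < n ≤ 2M} Λ(n)/n ≤ ψ(2M)/M ≤ 2(log 4 + 4)` for `M ≥ 1`. -/
theorem sum_Ioc_vonMangoldt_div_le_block {M : ℕ} (hM : 1 ≤ M) :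
    ∑ n ∈ Finset.Ioc M (2 * M), Λ n / (n : ℝ) ≤ 2 * (Real.log 4 + 4) := by
  have hM0 : (0 : ℝ) < M := by exact_mod_cast hM
  have hψ : ∑ n ∈ Finset.Ioc M (2 * M), Λ n ≤ ψ ((2 * M : ℕ) : ℝ) := by
    rw [Chebyshev.psi, Nat.floor_natCast]
    exact Finset.sum_le_sum_of_subset_of_nonneg (Finset.Ioc_subset_Ioc_left (Nat.zero_le M))
      fun _ _ _ ↦ ArithmeticFunction.vonMangoldt_nonneg
  have hC := Chebyshev.psi_le_const_mul_self (x := ((2 * M : ℕ) : ℝ)) (by positivity)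
  calc ∑ n ∈ Finset.Ioc M (2 * M), Λ n / (n : ℝ)
      ≤ ∑ n ∈ Finset.Ioc M (2 * M), Λ n / (M : ℝ) := by
        refine Finset.sum_le_sum fun n hn ↦ ?_
        rw [Finset.mem_Ioc] at hn
        exact div_le_div_of_nonneg_left ArithmeticFunction.vonMangoldt_nonneg hM0
          (by exact_mod_cast hn.1.le)
    _ = (∑ n ∈ Finset.Ioc M (2 * M), Λ n) / M := by rw [Finset.sum_div]
    _ ≤ (Real.log 4 + 4) * ((2 * M : ℕ) : ℝ) / M := by gcongr; exact hψ.trans hC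
    _ = 2 * (Real.log 4 + 4) := by
        push_cast
        field_simp

/-- Dyadic sum: `Σ_{0 < n ≤ 2^K} Λ(n)/n ≤ 2(log 4 + 4) · K`. -/
theorem sum_vonMangoldt_div_le_dyadic (K : ℕ) :
    ∑ n ∈ Finset.Ioc 0 (2 ^ K), Λ n / (n : ℝ) ≤ 2 * (Real.log 4 + 4) * K := by
  induction K with
  | zero =>
    have h01 : Finset.Ioc 0 (2 ^ 0) = {1} := by decide
    rw [h01]
    simp [ArithmeticFunction.vonMangoldt_apply_one]
  | succ K ih =>
    have hle : 2 ^ K ≤ 2 * 2 ^ K := by omega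
    have hsplit : Finset.Ioc 0 (2 ^ (K + 1)) =
        Finset.Ioc 0 (2 ^ K) ∪ Finset.Ioc (2 ^ K) (2 * 2 ^ K) := by
      rw [pow_succ', Finset.Ioc_union_Ioc_eq_Ioc (Nat.zero_le _) hle]
    have hdisj : Disjoint (Finset.Ioc 0 (2 ^ K)) (Finset.Ioc (2 ^ K) (2 * 2 ^ K)) :=
      Finset.disjoint_left.2 fun n h1 h2 ↦ by
        rw [Finset.mem_Ioc] at h1 h2
        omega
    rw [hsplit, Finset.sum_union hdisj]
    have hb := sum_Ioc_vonMangoldt_div_le_block (M := 2 ^ K) Nat.one_le_two_pow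
    push_cast
    linarith

/-- `Σ_{n ≤ N} Λ(n)/n ≤ 22 log N + 11` (Chebyshev order; `N = 0` gives `0 ≤ 11`). -/
theorem sum_vonMangoldt_div_le (N : ℕ) :
    ∑ n ∈ Finset.Icc 1 N, Λ n / (n : ℝ) ≤ 22 * Real.log N + 11 := by
  rcases Nat.eq_zero_or_pos N with rfl | hN
  · simp
  have hNK : N ≤ 2 ^ (Nat.log 2 N + 1) := (Nat.lt_pow_succ_log_self one_lt_two N).le
  have h1 : ∑ n ∈ Finset.Icc 1 N, Λ n / (n : ℝ) ≤
      ∑ n ∈ Finset.Ioc 0 (2 ^ (Nat.log 2 N + 1)), Λ n / (n : ℝ) := by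
    have hIoc : Finset.Ioc 0 (2 ^ (Nat.log 2 N + 1)) = Finset.Icc 1 (2 ^ (Nat.log 2 N + 1)) := by
      ext n
      simp only [Finset.mem_Ioc, Finset.mem_Icc]
      omega
    rw [hIoc]
    exact Finset.sum_le_sum_of_subset_of_nonneg (Finset.Icc_subset_Icc_right hNK)
      fun n _ _ ↦ div_nonneg ArithmeticFunction.vonMangoldt_nonneg n.cast_nonneg
  have h2 := sum_vonMangoldt_div_le_dyadic (Nat.log 2 N + 1)
  -- `Nat.log 2 N ≤ log N / log 2 ≤ 2 log N`
  have hlogN : 0 ≤ Real.log N := Real.log_natCast_nonneg N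
  have hl2 := Real.log_two_gt_d9
  have hl2' := Real.log_two_lt_d9
  have hpow : (2 : ℝ) ^ Nat.log 2 N ≤ N := by
    exact_mod_cast Nat.pow_log_le_self 2 hN.ne'
  have hlog : (Nat.log 2 N : ℝ) * Real.log 2 ≤ Real.log N := by
    have h := Real.log_le_log (by positivity) hpow
    rwa [Real.log_pow] at h
  have hK : ((Nat.log 2 N + 1 : ℕ) : ℝ) ≤ 2 * Real.log N + 1 := by
    push_cast
    nlinarith
  have h4 : Real.log 4 = 2 * Real.log 2 := by
    rw [show (4 : ℝ) = 2 ^ 2 by norm_num, Real.log_pow]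
    norm_num
  have hC0 : 0 ≤ 2 * (Real.log 4 + 4) := by rw [h4]; positivity
  calc ∑ n ∈ Finset.Icc 1 N, Λ n / (n : ℝ)
      ≤ 2 * (Real.log 4 + 4) * ((Nat.log 2 N + 1 : ℕ) : ℝ) := h1.trans h2
    _ ≤ 2 * (Real.log 4 + 4) * (2 * Real.log N + 1) := mul_le_mul_of_nonneg_left hK hC0
    _ ≤ 22 * Real.log N + 11 := by rw [h4]; nlinarith

/-- `Σ_{n ≤ N} Λ(n)²/n ≤ log N · (22 log N + 11)` (from `Λ(n) ≤ log n ≤ log N`). -/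
theorem sum_vonMangoldt_sq_div_le (N : ℕ) :
    ∑ n ∈ Finset.Icc 1 N, Λ n ^ 2 / (n : ℝ) ≤ Real.log N * (22 * Real.log N + 11) := by
  have h : ∀ n ∈ Finset.Icc 1 N, Λ n ^ 2 / (n : ℝ) ≤ Real.log N * (Λ n / (n : ℝ)) := by
    intro n hn
    rw [Finset.mem_Icc] at hn
    have hlog : Λ n ≤ Real.log N :=
      ArithmeticFunction.vonMangoldt_le_log.trans
        (Real.log_le_log (by exact_mod_cast hn.1) (by exact_mod_cast hn.2))
    rw [sq, mul_div_assoc]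
    exact mul_le_mul_of_nonneg_right hlog
      (div_nonneg ArithmeticFunction.vonMangoldt_nonneg n.cast_nonneg)
  calc ∑ n ∈ Finset.Icc 1 N, Λ n ^ 2 / (n : ℝ)
      ≤ ∑ n ∈ Finset.Icc 1 N, Real.log N * (Λ n / (n : ℝ)) := Finset.sum_le_sum h
    _ = Real.log N * ∑ n ∈ Finset.Icc 1 N, Λ n / (n : ℝ) := (Finset.mul_sum _ _ _).symm
    _ ≤ Real.log N * (22 * Real.log N + 11) :=
        mul_le_mul_of_nonneg_left (sum_vonMangoldt_div_le N) (Real.log_natCast_nonneg N)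

end Summit.RiemannHypothesis.RiemannHypothesis.Theorems

end
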